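import Mathlib
import Literature.MathematicalPhysics.QuantumFieldTheory.Balaban1983to89.B1RT

/-!
# `Balaban1983to89.B1Ineq36LowerStep` — B1 §3 p. 613 (3.6) [Balaban1982Higgs1]: the first lower-bound step
# `Z^ε ≥ ∫dB∫dψ χ₁(B)χ₁(ψ)T^ε_{a,L}[T^ε_{a,L,A}[χ₀(A)χ₀(φ)exp(−S^ε)]]` — its MECHANISM proved for every
# normalized non-negative integral kernel, with the instances for the transformation (2.4) and for the double
# transformation of (3.6) as one product kernel

statement-level skeleton of published theorems with citation tags; proofs where landed; nothing here is a claim about the Yang–Mills mass gap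

B1 = T. Bałaban, *(Higgs)₂,₃ quantum fields in a finite volume. I. A lower bound*, Commun. Math. Phys. **85**,
603–626 (1982) [Balaban1982Higgs1] (held: `paper:balaban1982-cmp85-higgs23-i`; journal page = PDF page + 602;
render `…/pages/1982-cmp85-higgs23-I/1982-cmp85-higgs23-I-p011-x2.png` = p. 613).  Unit `lit-balaban-r14` gen 2
(READER/TYPER of B1–B2, B1 fold owner), SKELETON row B1.Eq3.6, v1 2026-08-21.

THE SOURCE TEXT, verbatim, p. 613 [PDF 11] (after the definitions (3.1)–(3.2) of χ₀(A), χ₀(φ), (3.3) of B^{(1),ε},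
ψ^{(1),ε} and (3.4)–(3.5) of χ₁(B), χ₁(ψ)): *"and the following inequality holds
Z^ε ≥ ∫dB∫dψ χ₁(B)χ₁(ψ)T^ε_{a,L}[T^ε_{a,L,A}[χ₀(A)χ₀(φ)exp(−S^ε)]]. (3.6)
We have to calculate T^ε_{a,L}[T^ε_{a,L,A}[χ₀(A)χ₀(φ)exp(−S^ε)]] under the restrictions on the fields B, ψ
introduced by the characteristic functions χ₁(B)χ₁(ψ)."*  No proof is printed; the inequality is the
conjunction of three facts stated earlier in the paper: Z^ε = ∫dA∫dφ exp(−S^ε) ((1.10) p. 605), the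
characteristic functions take values in [0, 1], and the renormalization transformations preserve the integral,
*"∫dψ ρ′(A,ψ) = ∫dφ ρ(A,φ)"* ((2.9) p. 609, `B1RT.integral_rtOp`), with non-negative kernels ((2.5)–(2.6)).

WHAT IS HERE (KERNEL-PROVED).  Section `Kernel`, over two σ-finite measure spaces (Φ, μ) ↤ the fine fields with
their Lebesgue measure, (Ψ, ν) ↤ the block fields, and a jointly measurable kernel T ≥ 0 with ∫T(ψ,φ)dν(ψ) = 1:
`integrable_uncurry_kernel_mul` (Tonelli step), `integral_integral_kernel_mul` ((2.9) in this generality),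
`integrable_integral_kernel_mul`, and **`integral_cutoff_kernel_cutoff_le`** = the mechanism of (3.6):
`∫dν χ₁·𝒯[χ₀ρ] ≤ ∫dμ ρ` for integrable ρ ≥ 0 and measurable cut-offs 0 ≤ χ₀, χ₁ ≤ 1.  Section `RT`: the
instance for ONE transformation (2.4) with the Gaussian block kernel (2.5), `integral_cutoff_rtOp_cutoff_le`
(`B1RT.rtOp (B1RT.blockKernel κ m)`, κ > 0, m continuous).  Section `Double`: the double transformation of (3.6)
— T_{a,L} on the vector field (A ↦ B) after T_{a,L,A} on the scalar field (φ ↦ ψ, kernel depending on A) — is ONE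
integral operator on the joint fields (A,φ) ↦ (B,ψ) with the product kernel `doubleKernel t₁ t₂ (B,ψ) (A,φ) =
t₁(B,A)·t₂(A;ψ,φ)`: `integral_doubleKernel` (normalization, `integral_prod_mul`), `measurable_doubleKernel`,
`doubleKernel_iterated` (= the printed iterated form T_{a,L}[T_{a,L,A}[ρ]](B,ψ), Fubini) and
**`integral_cutoff_double_cutoff_le`** = (3.6) for every such pair of kernels, every integrable joint density
ρ(A,φ) ≥ 0 (↤ exp(−S^ε)) and all measurable cut-offs χ₀(A,φ), χ₁(B,ψ) with values in [0,1] (↤ χ₀(A)χ₀(φ),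
χ₁(B)χ₁(ψ)).  NOT HERE: the concrete (Higgs)₂,₃ instance (vector field on bonds, `HiggsAveraging.renormTransf`,
the action (1.11)) — the typer's `B2Eq21FirstStep.doubleRT` (unit `lit-balaban-typer`, draft 2026-08-21) is the
concrete double transformation; it instantiates `integral_cutoff_double_cutoff_le`.
-/

open scoped BigOperators
open _root_.MeasureTheory

namespace Literature.MathematicalPhysics.QuantumFieldTheory.Balaban1983to89.B1Ineq36LowerStep

open B1RT

/-! ## The mechanism: a normalized non-negative kernel, an integrable density, two cut-offs -/

section Kernel

variable {Φ Ψ : Type*} [MeasurableSpace Φ] [MeasurableSpace Ψ] {μ : Measure Φ} {ν : Measure Ψ}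
  [SigmaFinite μ] [SigmaFinite ν]

/-- Tonelli step of (2.9) p. 609 in general form: for a jointly measurable kernel T ≥ 0 with ∫T(ψ,φ)dν(ψ) = 1 and
an integrable density g, the function (ψ,φ) ↦ T(ψ,φ)g(φ) is integrable for the product measure (its fibrewise
norm integrates to ‖g(φ)‖). [cite: Balaban1982Higgs1, (2.9) p.609] -/
theorem integrable_uncurry_kernel_mul {T : Ψ → Φ → ℝ} (hT : Measurable (Function.uncurry T))
    (hT0 : ∀ ψ φ, 0 ≤ T ψ φ) (hT1 : ∀ φ, ∫ ψ, T ψ φ ∂ν = 1) {g : Φ → ℝ} (hg : Integrable g μ) :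
    Integrable (Function.uncurry fun ψ φ => T ψ φ * g φ) (ν.prod μ) := by
  have hmeas : AEStronglyMeasurable (Function.uncurry fun ψ φ => T ψ φ * g φ) (ν.prod μ) :=
    hT.aestronglyMeasurable.mul hg.1.comp_snd
  rw [integrable_prod_iff' hmeas]
  refine ⟨Filter.Eventually.of_forall fun φ => ?_, ?_⟩
  · have hi : Integrable (fun ψ => T ψ φ) ν := by
      refine Integrable.of_integral_ne_zero ?_
      rw [hT1 φ]
      exact one_ne_zero
    simpa [Function.uncurry] using hi.mul_const (g φ)
  · have hpt : ∀ φ, ∫ ψ, ‖Function.uncurry (fun ψ φ => T ψ φ * g φ) (ψ, φ)‖ ∂ν = ‖g φ‖ := by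
      intro φ
      have : ∀ ψ, ‖Function.uncurry (fun ψ φ => T ψ φ * g φ) (ψ, φ)‖ = T ψ φ * ‖g φ‖ := by
        intro ψ
        simp only [Function.uncurry_apply_pair, norm_mul, Real.norm_of_nonneg (hT0 ψ φ)]
      simp_rw [this]
      rw [integral_mul_const, hT1 φ, one_mul]
    simp_rw [hpt]
    exact hg.norm

/-- **(2.9)** p. 609 in general form, *"∫dψ ρ′(A,ψ) = ∫dφ ρ(A,φ)"*: a normalized non-negative kernel operator
preserves the integral of every integrable density (Fubini). [cite: Balaban1982Higgs1, (2.9) p.609] -/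
theorem integral_integral_kernel_mul {T : Ψ → Φ → ℝ} (hT : Measurable (Function.uncurry T))
    (hT0 : ∀ ψ φ, 0 ≤ T ψ φ) (hT1 : ∀ φ, ∫ ψ, T ψ φ ∂ν = 1) {g : Φ → ℝ} (hg : Integrable g μ) :
    ∫ ψ, ∫ φ, T ψ φ * g φ ∂μ ∂ν = ∫ φ, g φ ∂μ := by
  rw [integral_integral_swap (integrable_uncurry_kernel_mul hT hT0 hT1 hg)]
  refine integral_congr_ae (Filter.Eventually.of_forall fun φ => ?_)
  simp only
  rw [integral_mul_const, hT1 φ, one_mul]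

/-- The transformed density ψ ↦ ∫T(ψ,φ)g(φ)dμ(φ) is integrable. [cite: Balaban1982Higgs1, (2.9) p.609] -/
theorem integrable_integral_kernel_mul {T : Ψ → Φ → ℝ} (hT : Measurable (Function.uncurry T))
    (hT0 : ∀ ψ φ, 0 ≤ T ψ φ) (hT1 : ∀ φ, ∫ ψ, T ψ φ ∂ν = 1) {g : Φ → ℝ} (hg : Integrable g μ) :
    Integrable (fun ψ => ∫ φ, T ψ φ * g φ ∂μ) ν :=
  (integrable_uncurry_kernel_mul hT hT0 hT1 hg).integral_prod_left

omit [MeasurableSpace Ψ] [SigmaFinite μ] in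
/-- The transformed density of a non-negative density is non-negative. [cite: Balaban1982Higgs1, (2.4) p.608] -/
theorem integral_kernel_mul_nonneg {T : Ψ → Φ → ℝ} (hT0 : ∀ ψ φ, 0 ≤ T ψ φ) {g : Φ → ℝ} (hg0 : ∀ φ, 0 ≤ g φ)
    (ψ : Ψ) : 0 ≤ ∫ φ, T ψ φ * g φ ∂μ :=
  integral_nonneg fun φ => mul_nonneg (hT0 ψ φ) (hg0 φ)

/-- **The mechanism of (3.6)** p. 613: for a jointly measurable kernel T ≥ 0 with ∫T(ψ,φ)dν(ψ) = 1, an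
integrable density ρ ≥ 0 (↤ exp(−S^ε)) and measurable cut-offs χ₀, χ₁ with values in [0,1] (↤ the characteristic
functions (3.1)–(3.2) and (3.4)–(3.5)): `∫dν χ₁·𝒯[χ₀ρ] ≤ ∫dμ ρ` — insert χ₁ ≤ 1 (the transformed density is
≥ 0), use (2.9), insert χ₀ ≤ 1. [cite: Balaban1982Higgs1, (3.6) p.613] -/
theorem integral_cutoff_kernel_cutoff_le {T : Ψ → Φ → ℝ} (hT : Measurable (Function.uncurry T))
    (hT0 : ∀ ψ φ, 0 ≤ T ψ φ) (hT1 : ∀ φ, ∫ ψ, T ψ φ ∂ν = 1) {ρ : Φ → ℝ} (hρ : Integrable ρ μ)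
    (hρ0 : ∀ φ, 0 ≤ ρ φ) {χ₀ : Φ → ℝ} {χ₁ : Ψ → ℝ} (hχ₀ : Measurable χ₀)
    (h₀ : ∀ φ, χ₀ φ ∈ Set.Icc (0 : ℝ) 1) (h₁ : ∀ ψ, χ₁ ψ ∈ Set.Icc (0 : ℝ) 1) :
    ∫ ψ, χ₁ ψ * ∫ φ, T ψ φ * (χ₀ φ * ρ φ) ∂μ ∂ν ≤ ∫ φ, ρ φ ∂μ := by
  -- the cut-off density χ₀ρ is integrable and non-negative
  have hg : Integrable (fun φ => χ₀ φ * ρ φ) μ := by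
    refine Integrable.bdd_mul hρ hχ₀.aestronglyMeasurable (c := 1) (Filter.Eventually.of_forall fun φ => ?_)
    rw [Real.norm_of_nonneg (h₀ φ).1]
    exact (h₀ φ).2
  have hg0 : ∀ φ, 0 ≤ χ₀ φ * ρ φ := fun φ => mul_nonneg (h₀ φ).1 (hρ0 φ)
  -- the transformed density is integrable and non-negative
  have hG : Integrable (fun ψ => ∫ φ, T ψ φ * (χ₀ φ * ρ φ) ∂μ) ν :=
    integrable_integral_kernel_mul hT hT0 hT1 hg
  have hG0 : ∀ ψ, 0 ≤ ∫ φ, T ψ φ * (χ₀ φ * ρ φ) ∂μ := integral_kernel_mul_nonneg hT0 hg0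
  calc ∫ ψ, χ₁ ψ * ∫ φ, T ψ φ * (χ₀ φ * ρ φ) ∂μ ∂ν
      ≤ ∫ ψ, ∫ φ, T ψ φ * (χ₀ φ * ρ φ) ∂μ ∂ν :=
        integral_mono_of_nonneg (Filter.Eventually.of_forall fun ψ => mul_nonneg (h₁ ψ).1 (hG0 ψ)) hG
          (Filter.Eventually.of_forall fun ψ => mul_le_of_le_one_left (hG0 ψ) (h₁ ψ).2)
    _ = ∫ φ, χ₀ φ * ρ φ ∂μ := integral_integral_kernel_mul hT hT0 hT1 hg
    _ ≤ ∫ φ, ρ φ ∂μ :=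
        integral_mono_of_nonneg (Filter.Eventually.of_forall hg0) hρ
          (Filter.Eventually.of_forall fun φ => mul_le_of_le_one_left (hρ0 φ) (h₀ φ).2)

end Kernel

/-! ## Instance: one renormalization transformation (2.4) with the Gaussian block kernel (2.5) -/

section RT

variable {V : Type*} [NormedAddCommGroup V] [InnerProductSpace ℝ V] [FiniteDimensional ℝ V]
  [MeasurableSpace V] [BorelSpace V]
variable {X Y : Type*} [Fintype X] [Fintype Y]

omit [FiniteDimensional ℝ V] [MeasurableSpace V] [BorelSpace V] [Fintype X] in
/-- The block kernel (2.5) is jointly continuous in (ψ, φ) when the block-average map is continuous.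
[cite: Balaban1982Higgs1, (2.5) p.608] -/
theorem continuous_uncurry_blockKernel (κ : ℝ) {m : (X → V) → Y → V} (hm : Continuous m) :
    Continuous (Function.uncurry (blockKernel (X := X) (Y := Y) κ m)) := by
  unfold blockKernel Function.uncurry
  refine continuous_finsetProd _ fun y _ => ?_
  exact (continuous_rtKernel κ).comp
    (((continuous_apply y).comp continuous_fst).sub ((continuous_apply y).comp (hm.comp continuous_snd)))

/-- (3.6)-shape for ONE transformation (2.4): with the kernel (2.5) `t(ψ,φ) = Π_y t_κ(ψ(y) − m(φ)(y))`, κ > 0, m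
continuous, every integrable density ρ ≥ 0 and measurable cut-offs 0 ≤ χ₀, χ₁ ≤ 1:
`∫dψ χ₁(ψ)(T_{a,L,A}[χ₀ρ])(ψ) ≤ ∫dφ ρ(φ)`. [cite: Balaban1982Higgs1, (3.6) p.613] -/
theorem integral_cutoff_rtOp_cutoff_le {κ : ℝ} (hκ : 0 < κ) {m : (X → V) → Y → V} (hm : Continuous m)
    {ρ : (X → V) → ℝ} (hρ : Integrable ρ) (hρ0 : ∀ φ, 0 ≤ ρ φ) {χ₀ : (X → V) → ℝ} {χ₁ : (Y → V) → ℝ}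
    (hχ₀ : Measurable χ₀) (h₀ : ∀ φ, χ₀ φ ∈ Set.Icc (0 : ℝ) 1) (h₁ : ∀ ψ, χ₁ ψ ∈ Set.Icc (0 : ℝ) 1) :
    ∫ ψ, χ₁ ψ * rtOp (blockKernel κ m) (fun φ => χ₀ φ * ρ φ) ψ ≤ ∫ φ, ρ φ := by
  simp only [rtOp_eq]
  exact integral_cutoff_kernel_cutoff_le (continuous_uncurry_blockKernel κ hm).measurable
    (fun ψ φ => blockKernel_nonneg hκ.le m ψ φ) (integral_blockKernel hκ m) hρ hρ0 hχ₀ h₀ h₁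

end RT

/-! ## Instance: the double transformation `T_{a,L}[T_{a,L,A}[·]]` of (3.6) as one product kernel -/

section Double

variable {Φ₁ Φ₂ Ψ₁ Ψ₂ : Type*} [MeasurableSpace Φ₁] [MeasurableSpace Φ₂] [MeasurableSpace Ψ₁]
  [MeasurableSpace Ψ₂] {μ₁ : Measure Φ₁} {μ₂ : Measure Φ₂} {ν₁ : Measure Ψ₁} {ν₂ : Measure Ψ₂}
  [SigmaFinite μ₁] [SigmaFinite μ₂] [SigmaFinite ν₁] [SigmaFinite ν₂]

/-- The kernel of the double transformation of (3.6) on the joint fields: DICTIONARY `Φ₁` ↤ vector fields A,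
`Φ₂` ↤ scalar fields φ, `Ψ₁` ↤ block vector fields B, `Ψ₂` ↤ block scalar fields ψ, `t₁ B A` ↤ the kernel of
T^ε_{a,L} (the transformation (2.4)–(2.5) with U = 1 on the vector field), `t₂ A ψ φ` ↤ the kernel of T^ε_{a,L,A}
((2.5)–(2.6), depending on A through Q(A)); the joint kernel is their product. [cite: Balaban1982Higgs1, (3.6) p.613] -/
def doubleKernel (t₁ : Ψ₁ → Φ₁ → ℝ) (t₂ : Φ₁ → Ψ₂ → Φ₂ → ℝ) (bψ : Ψ₁ × Ψ₂) (aφ : Φ₁ × Φ₂) : ℝ :=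
  t₁ bψ.1 aφ.1 * t₂ aφ.1 bψ.2 aφ.2

omit [MeasurableSpace Φ₁] [MeasurableSpace Φ₂] [MeasurableSpace Ψ₁] [MeasurableSpace Ψ₂] in
/-- Unfolding lemma (definitional). [cite: Balaban1982Higgs1, (3.6) p.613] -/
theorem doubleKernel_apply (t₁ : Ψ₁ → Φ₁ → ℝ) (t₂ : Φ₁ → Ψ₂ → Φ₂ → ℝ) (bψ : Ψ₁ × Ψ₂) (aφ : Φ₁ × Φ₂) :
    doubleKernel t₁ t₂ bψ aφ = t₁ bψ.1 aφ.1 * t₂ aφ.1 bψ.2 aφ.2 := rfl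

omit [MeasurableSpace Φ₁] [MeasurableSpace Φ₂] [MeasurableSpace Ψ₁] [MeasurableSpace Ψ₂] in
/-- The product kernel is non-negative. [cite: Balaban1982Higgs1, (3.6) p.613] -/
theorem doubleKernel_nonneg {t₁ : Ψ₁ → Φ₁ → ℝ} {t₂ : Φ₁ → Ψ₂ → Φ₂ → ℝ} (h₁ : ∀ b a, 0 ≤ t₁ b a)
    (h₂ : ∀ a ψ φ, 0 ≤ t₂ a ψ φ) (bψ : Ψ₁ × Ψ₂) (aφ : Φ₁ × Φ₂) : 0 ≤ doubleKernel t₁ t₂ bψ aφ :=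
  mul_nonneg (h₁ _ _) (h₂ _ _ _)

/-- The product kernel is jointly measurable when its factors are. [cite: Balaban1982Higgs1, (3.6) p.613] -/
theorem measurable_doubleKernel {t₁ : Ψ₁ → Φ₁ → ℝ} {t₂ : Φ₁ → Ψ₂ → Φ₂ → ℝ}
    (h₁ : Measurable (Function.uncurry t₁)) (h₂ : Measurable fun p : Φ₁ × Ψ₂ × Φ₂ => t₂ p.1 p.2.1 p.2.2) :
    Measurable (Function.uncurry (doubleKernel t₁ t₂)) := by
  have e1 : Measurable fun q : (Ψ₁ × Ψ₂) × (Φ₁ × Φ₂) => t₁ q.1.1 q.2.1 :=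
    h₁.comp (measurable_fst.fst.prodMk measurable_snd.fst)
  have e2 : Measurable fun q : (Ψ₁ × Ψ₂) × (Φ₁ × Φ₂) => t₂ q.2.1 q.1.2 q.2.2 :=
    h₂.comp (measurable_snd.fst.prodMk (measurable_fst.snd.prodMk measurable_snd.snd))
  exact e1.mul e2

omit [MeasurableSpace Φ₁] [MeasurableSpace Φ₂] in
/-- Normalization of the product kernel: ∫dB∫dψ t₁(B,A)t₂(A;ψ,φ) = (∫dB t₁(B,A))·(∫dψ t₂(A;ψ,φ)) = 1 — (2.8)/(2.9)
for both transformations. [cite: Balaban1982Higgs1, (2.8)–(2.9) p.609, (3.6) p.613] -/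
theorem integral_doubleKernel {t₁ : Ψ₁ → Φ₁ → ℝ} {t₂ : Φ₁ → Ψ₂ → Φ₂ → ℝ} (n₁ : ∀ a, ∫ b, t₁ b a ∂ν₁ = 1)
    (n₂ : ∀ a φ, ∫ ψ, t₂ a ψ φ ∂ν₂ = 1) (aφ : Φ₁ × Φ₂) :
    ∫ bψ, doubleKernel t₁ t₂ bψ aφ ∂(ν₁.prod ν₂) = 1 := by
  simp only [doubleKernel_apply]
  rw [integral_prod_mul (fun b => t₁ b aφ.1) (fun ψ => t₂ aφ.1 ψ aφ.2), n₁, n₂, one_mul]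

omit [MeasurableSpace Ψ₁] [MeasurableSpace Ψ₂] in
/-- The one-kernel form IS the printed iterated form: ∫∫ t₁(B,A)t₂(A;ψ,φ)ρ(A,φ) dA dφ =
∫dA t₁(B,A) ∫dφ t₂(A;ψ,φ)ρ(A,φ) = (T_{a,L}[T_{a,L,A}[ρ]])(B,ψ), whenever the joint integrand is integrable (Fubini).
[cite: Balaban1982Higgs1, (3.6) p.613] -/
theorem doubleKernel_iterated (t₁ : Ψ₁ → Φ₁ → ℝ) (t₂ : Φ₁ → Ψ₂ → Φ₂ → ℝ) (ρ : Φ₁ × Φ₂ → ℝ) (bψ : Ψ₁ × Ψ₂)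
    (h : Integrable (fun aφ => doubleKernel t₁ t₂ bψ aφ * ρ aφ) (μ₁.prod μ₂)) :
    ∫ aφ, doubleKernel t₁ t₂ bψ aφ * ρ aφ ∂(μ₁.prod μ₂) =
      ∫ a, t₁ bψ.1 a * ∫ φ, t₂ a bψ.2 φ * ρ (a, φ) ∂μ₂ ∂μ₁ := by
  rw [integral_prod _ h]
  refine integral_congr_ae (Filter.Eventually.of_forall fun a => ?_)
  simp only [doubleKernel_apply]
  rw [← integral_const_mul]
  refine integral_congr_ae (Filter.Eventually.of_forall fun φ => ?_)
  simp only
  ring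

/-- **(3.6)** p. 613 for the double transformation: for kernels t₁ ≥ 0 (T_{a,L}) and t₂ ≥ 0 (T_{a,L,A}, depending
on A) with the normalizations (2.8)/(2.9), every integrable joint density ρ(A,φ) ≥ 0 (↤ exp(−S^ε(A,φ)), so that
∫ρ = Z^ε by (1.10)) and all measurable cut-offs χ₀(A,φ), χ₁(B,ψ) with values in [0,1] (↤ χ₀(A)χ₀(φ) of
(3.1)–(3.2), χ₁(B)χ₁(ψ) of (3.4)–(3.5)):
`∫dB∫dψ χ₁ · T_{a,L}[T_{a,L,A}[χ₀ρ]] ≤ ∫dA∫dφ ρ = Z^ε`. [cite: Balaban1982Higgs1, (3.6) p.613] -/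
theorem integral_cutoff_double_cutoff_le {t₁ : Ψ₁ → Φ₁ → ℝ} {t₂ : Φ₁ → Ψ₂ → Φ₂ → ℝ}
    (h₁ : Measurable (Function.uncurry t₁)) (h₂ : Measurable fun p : Φ₁ × Ψ₂ × Φ₂ => t₂ p.1 p.2.1 p.2.2)
    (p₁ : ∀ b a, 0 ≤ t₁ b a) (p₂ : ∀ a ψ φ, 0 ≤ t₂ a ψ φ) (n₁ : ∀ a, ∫ b, t₁ b a ∂ν₁ = 1)
    (n₂ : ∀ a φ, ∫ ψ, t₂ a ψ φ ∂ν₂ = 1) {ρ : Φ₁ × Φ₂ → ℝ} (hρ : Integrable ρ (μ₁.prod μ₂))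
    (hρ0 : ∀ aφ, 0 ≤ ρ aφ) {χ₀ : Φ₁ × Φ₂ → ℝ} {χ₁ : Ψ₁ × Ψ₂ → ℝ} (hχ₀ : Measurable χ₀)
    (c₀ : ∀ aφ, χ₀ aφ ∈ Set.Icc (0 : ℝ) 1) (c₁ : ∀ bψ, χ₁ bψ ∈ Set.Icc (0 : ℝ) 1) :
    ∫ bψ, χ₁ bψ * ∫ aφ, doubleKernel t₁ t₂ bψ aφ * (χ₀ aφ * ρ aφ) ∂(μ₁.prod μ₂) ∂(ν₁.prod ν₂) ≤
      ∫ aφ, ρ aφ ∂(μ₁.prod μ₂) :=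
  integral_cutoff_kernel_cutoff_le (measurable_doubleKernel h₁ h₂) (doubleKernel_nonneg p₁ p₂)
    (integral_doubleKernel n₁ n₂) hρ hρ0 hχ₀ c₀ c₁

end Double

/-! ## A chain of transformations (v1.1): the iterated (2.9) — B1 (2.16) p. 609; B2 (3.32) p. 588, (3.36) = (3.37) p. 591

v1.1 (unit `lit-balaban-r14` gen 4, 2026-08-21; APPEND-ONLY, v1 declarations above byte-identical).  Part I composes
renormalization transformations along the tower of lattices (*"T_{a_k,L^k,A} = T_{a,L,A^{L^{k−1}η}} T_{a,L,A^{L^{k−2}η}} …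
T_{a,L,A}"*, (2.16) p. 609) and part II integrates such chains scale after scale: p. 588 *"∫dφ_{k+1}↾_X (T_{a,L,Ã}ρ)(…)
= ∫dφ_k↾_{B¹(X)} ρ(…) (3.32)"* (one step = (I.2.9) = `integral_integral_kernel_mul` above) and p. 591 *"We apply the
formula (3.23) to the underintegral expression. Next we use (3.32) again and it follows that the integral (3.36) is
equal to ∫dφ₀ exp(−½⟨φ₀,(−Δ^ε_{Ã^ε} + m²)φ₀⟩). (3.37)"* — i.e. (3.32) applied once per scale, K times.  The
mechanism, KERNEL-PROVED here in the generality of section `Kernel`: a `KernelChain` = an ℕ-indexed family of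
σ-finite measure spaces (Φ_i, μ_i) (↤ the field spaces at the successive scales with their Lebesgue measures) and
jointly measurable kernels T_i ≥ 0 from level i to level i + 1 with ∫T_i(ψ,φ)dμ_{i+1}(ψ) = 1 (↤ the kernels (2.5)/(II.3.1)
of the successive transformations); `chainOp g n` = the density after n transformations; `integrable_chainOp`,
**`integral_chainOp`** (`∫dμ_n chainOp g n = ∫dμ₀ g` — (3.32) n times), `chainOp_nonneg`, and the n-step version of
the (3.6)/(3.26) mechanism `integral_cutoff_chainOp_cutoff_le` (`∫dμ_n χ₁·chain[χ₀ρ] ≦ ∫dμ₀ ρ`).  SCHEMATIC: the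
multi-scale bookkeeping of (3.23)/(3.36) (fields restricted to the regions Λ₅^{(k−1)′}∩Λ₅^{(k)c}, the factor
exp(½log2·Σ|Λ_k|) of (3.36)) is not modelled — only the integral-preservation along the chain is.
-/

section Chain

/-- A chain of field spaces and normalized non-negative transformation kernels: `Φ i` ↤ the field configurations
at scale i (Lebesgue measure `μ i`), `T i ψ φ` ↤ the kernel of the (i+1)-st renormalization transformation
((2.5) p. 608 / II (3.1)), jointly measurable, `≥ 0`, normalized in its first argument ((2.8)/(2.9) p. 609).
[cite: Balaban1982Higgs1, (2.16) p.609] -/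
structure KernelChain where
  /-- the field space at scale `i` -/
  Φ : ℕ → Type
  mΦ : ∀ i, MeasurableSpace (Φ i)
  /-- its (Lebesgue) measure -/
  μ : ∀ i, Measure (Φ i)
  sigmaFinite : ∀ i, SigmaFinite (μ i)
  /-- the kernel of the transformation from scale `i` to scale `i + 1` -/
  T : ∀ i, Φ (i + 1) → Φ i → ℝ
  T_meas : ∀ i, Measurable (Function.uncurry (T i))
  T_nonneg : ∀ i ψ φ, 0 ≤ T i ψ φ
  T_norm : ∀ i φ, ∫ ψ, T i ψ φ ∂(μ (i + 1)) = 1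

attribute [instance] KernelChain.mΦ KernelChain.sigmaFinite

namespace KernelChain

variable (K : KernelChain)

/-- The density after `n` successive transformations of the chain applied to the scale-0 density `g`:
`chainOp g 0 = g`, `chainOp g (n+1) = 𝒯_n[chainOp g n]` ((2.4) p. 608 iterated as in (2.16)).
[cite: Balaban1982Higgs1, (2.4) p.608, (2.16) p.609] -/
noncomputable def chainOp (g : K.Φ 0 → ℝ) : (n : ℕ) → K.Φ n → ℝ
  | 0 => g
  | n + 1 => fun ψ => ∫ φ, K.T n ψ φ * chainOp g n φ ∂(K.μ n)

/-- Zero steps: the identity (definitional). [cite: Balaban1982Higgs1, (2.16) p.609] -/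
theorem chainOp_zero (g : K.Φ 0 → ℝ) : K.chainOp g 0 = g := rfl

/-- One more step: `chainOp g (n+1) ψ = ∫ T_n(ψ,φ)·chainOp g n φ dμ_n(φ)` (definitional). [cite: Balaban1982Higgs1, (2.16) p.609] -/
theorem chainOp_succ (g : K.Φ 0 → ℝ) (n : ℕ) (ψ : K.Φ (n + 1)) :
    K.chainOp g (n + 1) ψ = ∫ φ, K.T n ψ φ * K.chainOp g n φ ∂(K.μ n) := rfl

/-- Every transformed density along the chain is integrable (Tonelli, step by step).
[cite: Balaban1982Higgs1, (2.9) p.609] -/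
theorem integrable_chainOp {g : K.Φ 0 → ℝ} (hg : Integrable g (K.μ 0)) :
    ∀ n, Integrable (K.chainOp g n) (K.μ n)
  | 0 => hg
  | n + 1 => integrable_integral_kernel_mul (K.T_meas n) (K.T_nonneg n) (K.T_norm n) (integrable_chainOp hg n)

/-- **The iterated (2.9) / II (3.32)**: the chain preserves the integral of every integrable density,
`∫dμ_n chainOp g n = ∫dμ₀ g` — part II p. 591: *"we use (3.32) again and it follows that the integral (3.36) is equal
to (3.37)"*. [cite: Balaban1982Higgs1, (2.9) p.609, (2.16) p.609] -/
theorem integral_chainOp {g : K.Φ 0 → ℝ} (hg : Integrable g (K.μ 0)) :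
    ∀ n, ∫ ψ, K.chainOp g n ψ ∂(K.μ n) = ∫ φ, g φ ∂(K.μ 0)
  | 0 => rfl
  | n + 1 => by
    have h := integral_integral_kernel_mul (K.T_meas n) (K.T_nonneg n) (K.T_norm n) (K.integrable_chainOp hg n)
    exact h.trans (integral_chainOp hg n)

/-- The chain preserves non-negativity of densities. [cite: Balaban1982Higgs1, (2.4) p.608] -/
theorem chainOp_nonneg {g : K.Φ 0 → ℝ} (hg0 : ∀ φ, 0 ≤ g φ) : ∀ n ψ, 0 ≤ K.chainOp g n ψ
  | 0 => hg0
  | n + 1 => fun ψ => integral_kernel_mul_nonneg (K.T_nonneg n) (chainOp_nonneg hg0 n) ψ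

/-- **The n-step form of the (3.6)/(3.26) mechanism**: for an integrable density `ρ ≥ 0` at scale 0 and measurable
cut-offs `χ₀` (scale 0) and `χ₁` (scale n) with values in `[0,1]`, `∫dμ_n χ₁·chain_n[χ₀ρ] ≦ ∫dμ₀ ρ`.
[cite: Balaban1982Higgs1, (3.6) p.613, (3.26) p.617] -/
theorem integral_cutoff_chainOp_cutoff_le {ρ : K.Φ 0 → ℝ} (hρ : Integrable ρ (K.μ 0)) (hρ0 : ∀ φ, 0 ≤ ρ φ)
    {χ₀ : K.Φ 0 → ℝ} (hχ₀ : Measurable χ₀) (h₀ : ∀ φ, χ₀ φ ∈ Set.Icc (0 : ℝ) 1) (n : ℕ) {χ₁ : K.Φ n → ℝ}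
    (h₁ : ∀ ψ, χ₁ ψ ∈ Set.Icc (0 : ℝ) 1) :
    ∫ ψ, χ₁ ψ * K.chainOp (fun φ => χ₀ φ * ρ φ) n ψ ∂(K.μ n) ≤ ∫ φ, ρ φ ∂(K.μ 0) := by
  have hg : Integrable (fun φ => χ₀ φ * ρ φ) (K.μ 0) := by
    refine Integrable.bdd_mul hρ hχ₀.aestronglyMeasurable (c := 1) (Filter.Eventually.of_forall fun φ => ?_)
    rw [Real.norm_of_nonneg (h₀ φ).1]
    exact (h₀ φ).2
  have hg0 : ∀ φ, 0 ≤ χ₀ φ * ρ φ := fun φ => mul_nonneg (h₀ φ).1 (hρ0 φ)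
  have hG : Integrable (K.chainOp (fun φ => χ₀ φ * ρ φ) n) (K.μ n) := K.integrable_chainOp hg n
  have hG0 : ∀ ψ, 0 ≤ K.chainOp (fun φ => χ₀ φ * ρ φ) n ψ := K.chainOp_nonneg hg0 n
  calc ∫ ψ, χ₁ ψ * K.chainOp (fun φ => χ₀ φ * ρ φ) n ψ ∂(K.μ n)
      ≤ ∫ ψ, K.chainOp (fun φ => χ₀ φ * ρ φ) n ψ ∂(K.μ n) :=
        integral_mono_of_nonneg (Filter.Eventually.of_forall fun ψ => mul_nonneg (h₁ ψ).1 (hG0 ψ)) hG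
          (Filter.Eventually.of_forall fun ψ => mul_le_of_le_one_left (hG0 ψ) (h₁ ψ).2)
    _ = ∫ φ, χ₀ φ * ρ φ ∂(K.μ 0) := K.integral_chainOp hg n
    _ ≤ ∫ φ, ρ φ ∂(K.μ 0) :=
        integral_mono_of_nonneg (Filter.Eventually.of_forall hg0) hρ
          (Filter.Eventually.of_forall fun φ => mul_le_of_le_one_left (hρ0 φ) (h₀ φ).2)

end KernelChain

end Chain

end Literature.MathematicalPhysics.QuantumFieldTheory.Balaban1983to89.B1Ineq36LowerStep
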